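import Summits.ResolutionOfSingularities.ResolutionOfSingularities.Theorems.EquisingularLiftEquisingularLiftNatResidueHypDefs8
import HarnessLib

/-!
# [OURS · L1 W4.5(b) · EL♮ / EL♮(3)] RESIDUE HYPOTHESIS DEFS 9 — the «NESTED HOST / KEPT MEMBERS» ISO blob (WIDTH TABLE D7; desk R62/R64/R65 «D7-PRE»):
# `PrefixReachKeyLetterParam7` (= Defs8's `PrefixReachKeyLetterParam` with the hosted-round clause (HR) REPLACED by ONE clause (HR-KEEP), every other clause and END byte-equal),
# its instance `PrefixReachKeyLetterP7`, the blob `IsoHypReachNDLeavesP7`, and the PURE inclusions from P6 / P5 / P + the REPLACE lemma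

PEN (desk R65 (i)): res-type-027 g22.  OURS; NAMED HYPOTHESES, not statements of any manuscript; nothing of [Hironaka2017] asserted; AI-written, weaker than expert
review; resolution of singularities in positive characteristic is NOT proved here, EL♮(3) is NOT proved here.  `--kind definition --supports stmt-ResolutionOfSingularities-20148 --as helper`.

THE ONE CHANGE vs Defs8 (✓ p675913's `PrefixReachKeyLetterParam`, text v1.1 df0014a1b76d223c + `Z.Infinite →` in (ii)): clause (HR) «hosted round in a listed host `E₁`,
every OTHER letter and the tag dropped, output `[St E₁] none`» becomes clause **(HR-KEEP)** «hosted round in a listed host `E₁` THAT KEEPS ITS MEMBERS»: antecedents =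
(HR)'s VERBATIM (`E₁ ∈ Ls`, `Z ⊆ closure E₁`, `Z ⊆ T₁`, `¬ T₁ ⊆ Z`, `Z̃` regular, `Ẽ₁` regular along `Z̃`, `DirStepUnobs F₁ (closure E₁) _ Z hZ`, curve clause) PLUS,
immediately before `IsBlowup υ' 𝓘⟨Z⟩ →`, the pair clause's «other members» block with `E₁` in the rôle of `A, B, K`: `∀ L ∈ Ls, L ≠ E₁ → 𝓘⟨cl L⟩ ⊔ 𝓘⟨Z⟩ = 𝓘⟨cl L ∩ Z⟩ ∧
∀ z ∈ Z, IsClosed {z} → ¬ 𝓘⟨cl L⟩_z ≤ 𝓘⟨Z⟩_z` (= the `hOthers` binder of ✓/⊙ `TCPlus.hround_keep`, p682536, VERBATIM); consequent = ONE output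
`Q F₃ (υ' ≫ ρ) (closure (υ'⁻¹(T₁ ∖ Z))) (Ls.map St ++ [υ'⁻¹ Z]) none` — every listed letter steps to its strict transform, the exceptional letter `υ'⁻¹ Z` is BORN and LISTED
(so a later hosted round may take it as its host: no bound on the number of nested rounds), the tag is dropped.  NO «`F₁` regular along `Z`» antecedent (desk R64 (iii)).
PURE LOGIC: a motive closed under (D) and (HR-KEEP) is closed under (HR) — drop to `[E₁] none`, run (HR-KEEP) at `Ls := [E₁]` (member block vacuous), drop to `[St E₁]` —
hence `prefixReachKeyLetterP7_of_P6` and the blob inclusions ★ `isoHypReachNDLeavesP7_of_P6` / `_of_P5` / `_of_P`, and the REPLACE lemma `not_isoHypReachNDLeavesP6_of_not_P7`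
(vs the REGISTERED hypothesis of `stub_elnat_three_isolated_nonNDLeaves6`): the cut `¬ IsoHypReachNDLeavesP6 ↦ ¬ IsoHypReachNDLeavesP7` loses nothing.  Customers of record
(lead-1 DEEP-TAIL-CUSTOMERS v1.0/v1.1): N8 (9-move word, two nested hosted rounds) and N7 (10-move word, a kept non-host member through a hosted round).  Engine: K5⁷ =
✓ `target_elnat_of_letteredPrefixResolution` re-cut with the HROUND slot discharged by `TCPlus.hround_keep` (desk R65 (iii); separate file).
-/

set_option linter.dupNamespace false
noncomputable section
open CategoryTheory CategoryTheory.Limits AlgebraicGeometry TopologicalSpace Topology IsLocalRing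
open Literature.AlgebraicGeometry.Resolution
open AlgebraicGeometry.Scheme.IdealSheafData

namespace Summit.ResolutionOfSingularities.ResolutionOfSingularities.Cruxes.EquisingularLiftNat.Sections

/-- **`PrefixReachKeyLetterParam7 k n H ι Reach ReachL LS Open F' ρ' T'`** — Defs8's `PrefixReachKeyLetterParam` (the K5⁶ `hres` block, text v1.1 + `Z.Infinite →` in (ii))
with the hosted-round clause (HR) REPLACED by (HR-KEEP) «hosted round that keeps its members» (desk R64 (ii) / R65 (i)); clauses (0)(D)(Pc)(PL)(i)(O)(ii) and END byte-equal.
See the module docstring. [OURS · L1 W4.5b · named predicate, no mathematical content of its own] -/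
def PrefixReachKeyLetterParam7 (k : Type) [Field k] [IsAlgClosed k] (n : ℕ) (H : AlgebraicGeometry.Scheme.{0})
    (ι : H ⟶ (Literature.AlgebraicGeometry.Motives.projectiveSpace n k).left)
    (Reach : ∀ (F₁ F₂ : AlgebraicGeometry.Scheme.{0}), (F₂ ⟶ F₁) → F₁ → Set F₂ → ∀ (F₉ : AlgebraicGeometry.Scheme.{0}), (F₉ ⟶ F₂) → Set F₉ → Prop)
    (ReachL : ∀ (F₂ : AlgebraicGeometry.Scheme.{0}), (F₂ ⟶ (Literature.AlgebraicGeometry.Motives.projectiveSpace n k).left) →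
      (Literature.AlgebraicGeometry.Motives.projectiveSpace n k).left → Set F₂ → List (Set F₂) → ∀ (F₉ : AlgebraicGeometry.Scheme.{0}), (F₉ ⟶ F₂) → Set F₉ → Prop)
    (LS : ∀ (F₂ : AlgebraicGeometry.Scheme.{0}), (F₂ ⟶ (Literature.AlgebraicGeometry.Motives.projectiveSpace n k).left) →
      (Literature.AlgebraicGeometry.Motives.projectiveSpace n k).left → List (Set F₂) → Prop)
    (Open : ∀ (F₃ : AlgebraicGeometry.Scheme.{0}), (F₃ ⟶ (Literature.AlgebraicGeometry.Motives.projectiveSpace n k).left) → Set F₃ → List (Set F₃) →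
      Option (Set F₃ × Set F₃ × Set F₃) → Prop)
    (F' : AlgebraicGeometry.Scheme.{0}) (ρ' : F' ⟶ (Literature.AlgebraicGeometry.Motives.projectiveSpace n k).left) (T' : Set F') : Prop :=
  ∀ Q : (∀ F₁ : AlgebraicGeometry.Scheme.{0}, (F₁ ⟶ (Literature.AlgebraicGeometry.Motives.projectiveSpace n k).left) → Set F₁ → List (Set F₁) →
      Option (Set F₁ × Set F₁ × Set F₁) → Prop),
    -- (0) START: no letters, no tag
    Q (Literature.AlgebraicGeometry.Motives.projectiveSpace n k).left (𝟙 (Literature.AlgebraicGeometry.Motives.projectiveSpace n k).left) (Set.range ι) [] none →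
    -- (D) DROP: forget listed letters (any sublist, as a set of names) and/or the tag
    (∀ (F₁ : AlgebraicGeometry.Scheme.{0}) (ρ : F₁ ⟶ (Literature.AlgebraicGeometry.Motives.projectiveSpace n k).left) (T₁ : Set F₁) (Ls Ls' : List (Set F₁))
        (Kp Kp' : Option (Set F₁ × Set F₁ × Set F₁)),
      Q F₁ ρ T₁ Ls Kp → (∀ L ∈ Ls', L ∈ Ls) → (Kp' = Kp ∨ Kp' = none) → Q F₁ ρ T₁ Ls' Kp') →
    -- (Pc) K5′'s POINT STEP + `Reach`-moves (PrefixReachBQuadPrime's first clause), from ANY slots, letters and tag DROPPED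
    (∀ (F₁ F₂ : AlgebraicGeometry.Scheme.{0}) (ρ : F₁ ⟶ (Literature.AlgebraicGeometry.Motives.projectiveSpace n k).left) (T₁ : Set F₁) (Ls : List (Set F₁))
        (Kp : Option (Set F₁ × Set F₁ × Set F₁))
        (x : ↥(AlgebraicGeometry.Scheme.IdealSheafData.vanishingIdeal (⟨closure T₁, isClosed_closure⟩ : TopologicalSpace.Closeds F₁)).subscheme) (υ : F₂ ⟶ F₁)
        (hx : IsClosed ({((AlgebraicGeometry.Scheme.IdealSheafData.vanishingIdeal
          (⟨closure T₁, isClosed_closure⟩ : TopologicalSpace.Closeds F₁)).subschemeι x : F₁)} : Set F₁)), Q F₁ ρ T₁ Ls Kp →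
      ¬ IsRegularLocalRing ((AlgebraicGeometry.Scheme.IdealSheafData.vanishingIdeal
          (⟨closure T₁, isClosed_closure⟩ : TopologicalSpace.Closeds F₁)).subscheme.presheaf.stalk x) →
      IsRegularLocalRing (F₁.presheaf.stalk ((AlgebraicGeometry.Scheme.IdealSheafData.vanishingIdeal
          (⟨closure T₁, isClosed_closure⟩ : TopologicalSpace.Closeds F₁)).subschemeι x)) → Literature.AlgebraicGeometry.Resolution.IsBlowup υ
        (AlgebraicGeometry.Scheme.IdealSheafData.vanishingIdeal (⟨{((AlgebraicGeometry.Scheme.IdealSheafData.vanishingIdeal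
            (⟨closure T₁, isClosed_closure⟩ : TopologicalSpace.Closeds F₁)).subschemeι x : F₁)}, hx⟩ : TopologicalSpace.Closeds F₁)) →
      Q F₂ (υ ≫ ρ) (closure (υ ⁻¹' (T₁ \ {((AlgebraicGeometry.Scheme.IdealSheafData.vanishingIdeal
          (⟨closure T₁, isClosed_closure⟩ : TopologicalSpace.Closeds F₁)).subschemeι x : F₁)}))) [] none ∧ (∀ (F₉ : AlgebraicGeometry.Scheme.{0}) (β : F₉ ⟶ F₂) (T₉ : Set F₉),
        Reach F₁ F₂ υ ((AlgebraicGeometry.Scheme.IdealSheafData.vanishingIdeal (⟨closure T₁, isClosed_closure⟩ : TopologicalSpace.Closeds F₁)).subschemeι x)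
          (closure (υ ⁻¹' (T₁ \ {((AlgebraicGeometry.Scheme.IdealSheafData.vanishingIdeal
            (⟨closure T₁, isClosed_closure⟩ : TopologicalSpace.Closeds F₁)).subschemeι x : F₁)}))) F₉ β T₉ → Q F₉ ((β ≫ υ) ≫ ρ) T₉ [] none)) →
    -- (PL) A⁗: at the INITIAL stage only, LETTERED `ReachL`-towers after a good point step (PrefixReachBQuadPrime's second clause), conclusion at `[] none`
    (∀ (F₂ : AlgebraicGeometry.Scheme.{0}) (x₀ : ↥(AlgebraicGeometry.Scheme.IdealSheafData.vanishingIdeal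
          (⟨closure (Set.range ι), isClosed_closure⟩ : TopologicalSpace.Closeds (Literature.AlgebraicGeometry.Motives.projectiveSpace n k).left)).subscheme)
        (υ : F₂ ⟶ (Literature.AlgebraicGeometry.Motives.projectiveSpace n k).left) (hx₀ : IsClosed ({((AlgebraicGeometry.Scheme.IdealSheafData.vanishingIdeal
          (⟨closure (Set.range ι), isClosed_closure⟩ : TopologicalSpace.Closeds (Literature.AlgebraicGeometry.Motives.projectiveSpace n k).left)).subschemeι x₀ : (Literature.AlgebraicGeometry.Motives.projectiveSpace n k).left)} : Set (Literature.AlgebraicGeometry.Motives.projectiveSpace n k).left))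
        (Ls₂ : List (Set F₂)), ¬ IsRegularLocalRing ((AlgebraicGeometry.Scheme.IdealSheafData.vanishingIdeal
          (⟨closure (Set.range ι), isClosed_closure⟩ : TopologicalSpace.Closeds (Literature.AlgebraicGeometry.Motives.projectiveSpace n k).left)).subscheme.presheaf.stalk x₀) →
      IsRegularLocalRing ((Literature.AlgebraicGeometry.Motives.projectiveSpace n k).left.presheaf.stalk ((AlgebraicGeometry.Scheme.IdealSheafData.vanishingIdeal
          (⟨closure (Set.range ι), isClosed_closure⟩ : TopologicalSpace.Closeds (Literature.AlgebraicGeometry.Motives.projectiveSpace n k).left)).subschemeι x₀ : (Literature.AlgebraicGeometry.Motives.projectiveSpace n k).left)) →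
      Literature.AlgebraicGeometry.Resolution.IsBlowup υ (AlgebraicGeometry.Scheme.IdealSheafData.vanishingIdeal (⟨{((AlgebraicGeometry.Scheme.IdealSheafData.vanishingIdeal
          (⟨closure (Set.range ι), isClosed_closure⟩ : TopologicalSpace.Closeds (Literature.AlgebraicGeometry.Motives.projectiveSpace n k).left)).subschemeι x₀ : (Literature.AlgebraicGeometry.Motives.projectiveSpace n k).left)}, hx₀⟩ : TopologicalSpace.Closeds (Literature.AlgebraicGeometry.Motives.projectiveSpace n k).left)) →
      LS F₂ υ ((AlgebraicGeometry.Scheme.IdealSheafData.vanishingIdeal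
          (⟨closure (Set.range ι), isClosed_closure⟩ : TopologicalSpace.Closeds (Literature.AlgebraicGeometry.Motives.projectiveSpace n k).left)).subschemeι x₀ : (Literature.AlgebraicGeometry.Motives.projectiveSpace n k).left) Ls₂ →
      ∀ (F₉ : AlgebraicGeometry.Scheme.{0}) (β : F₉ ⟶ F₂) (T₉ : Set F₉), ReachL F₂ υ ((AlgebraicGeometry.Scheme.IdealSheafData.vanishingIdeal
          (⟨closure (Set.range ι), isClosed_closure⟩ : TopologicalSpace.Closeds (Literature.AlgebraicGeometry.Motives.projectiveSpace n k).left)).subschemeι x₀ : (Literature.AlgebraicGeometry.Motives.projectiveSpace n k).left) (closure (υ ⁻¹' (Set.range ι \ {((AlgebraicGeometry.Scheme.IdealSheafData.vanishingIdeal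
          (⟨closure (Set.range ι), isClosed_closure⟩ : TopologicalSpace.Closeds (Literature.AlgebraicGeometry.Motives.projectiveSpace n k).left)).subschemeι x₀ : (Literature.AlgebraicGeometry.Motives.projectiveSpace n k).left)}))) Ls₂ F₉ β T₉ →
        Q F₉ (β ≫ υ) T₉ [] none) →
    -- (i) LETTERED POINT STEP at a closed non-regular point of `T̃`, regular on `F`: at most ONE listed letter THROUGH the point (`Lt = some L`: nested section,
    --     `L̃` regular at the point), every other listed letter AWAY, the tag's three letters AWAY; letters `↦ St`, tag `↦ St`, optional birth of `E_x = υ⁻¹{x}`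
    (∀ (F₁ F₂ : AlgebraicGeometry.Scheme.{0}) (ρ : F₁ ⟶ (Literature.AlgebraicGeometry.Motives.projectiveSpace n k).left) (T₁ : Set F₁) (Ls : List (Set F₁))
        (Kp : Option (Set F₁ × Set F₁ × Set F₁)) (Lt : Option (Set F₁))
        (x : ↥(AlgebraicGeometry.Scheme.IdealSheafData.vanishingIdeal (⟨closure T₁, isClosed_closure⟩ : TopologicalSpace.Closeds F₁)).subscheme) (υ : F₂ ⟶ F₁)
        (hx : IsClosed ({((AlgebraicGeometry.Scheme.IdealSheafData.vanishingIdeal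
          (⟨closure T₁, isClosed_closure⟩ : TopologicalSpace.Closeds F₁)).subschemeι x : F₁)} : Set F₁)), Q F₁ ρ T₁ Ls Kp →
      ¬ IsRegularLocalRing ((AlgebraicGeometry.Scheme.IdealSheafData.vanishingIdeal
          (⟨closure T₁, isClosed_closure⟩ : TopologicalSpace.Closeds F₁)).subscheme.presheaf.stalk x) →
      IsRegularLocalRing (F₁.presheaf.stalk ((AlgebraicGeometry.Scheme.IdealSheafData.vanishingIdeal
          (⟨closure T₁, isClosed_closure⟩ : TopologicalSpace.Closeds F₁)).subschemeι x)) →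
      (∀ L ∈ Ls, ((AlgebraicGeometry.Scheme.IdealSheafData.vanishingIdeal (⟨closure T₁, isClosed_closure⟩ : TopologicalSpace.Closeds F₁)).subschemeι x : F₁) ∈ closure L →
        Lt = some L) →
      (∀ L : Set F₁, Lt = some L → L ∈ Ls ∧ ∀ e : ↥(redSub F₁ (closure L) isClosed_closure), (redSubι F₁ (closure L) isClosed_closure e : F₁) =
          ((AlgebraicGeometry.Scheme.IdealSheafData.vanishingIdeal (⟨closure T₁, isClosed_closure⟩ : TopologicalSpace.Closeds F₁)).subschemeι x : F₁) →
        IsRegularLocalRing ((redSub F₁ (closure L) isClosed_closure).presheaf.stalk e)) →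
      (∀ K A C : Set F₁, Kp = some (K, A, C) →
        ((AlgebraicGeometry.Scheme.IdealSheafData.vanishingIdeal (⟨closure T₁, isClosed_closure⟩ : TopologicalSpace.Closeds F₁)).subschemeι x : F₁) ∉ closure K ∧
        ((AlgebraicGeometry.Scheme.IdealSheafData.vanishingIdeal (⟨closure T₁, isClosed_closure⟩ : TopologicalSpace.Closeds F₁)).subschemeι x : F₁) ∉ closure A ∧
        ((AlgebraicGeometry.Scheme.IdealSheafData.vanishingIdeal (⟨closure T₁, isClosed_closure⟩ : TopologicalSpace.Closeds F₁)).subschemeι x : F₁) ∉ closure C) →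
      Literature.AlgebraicGeometry.Resolution.IsBlowup υ
        (AlgebraicGeometry.Scheme.IdealSheafData.vanishingIdeal (⟨{((AlgebraicGeometry.Scheme.IdealSheafData.vanishingIdeal
            (⟨closure T₁, isClosed_closure⟩ : TopologicalSpace.Closeds F₁)).subschemeι x : F₁)}, hx⟩ : TopologicalSpace.Closeds F₁)) →
      ∀ Ls' : List (Set F₂),
        (Ls' = Ls.map (fun L => closure (υ ⁻¹' (L \ {((AlgebraicGeometry.Scheme.IdealSheafData.vanishingIdeal
            (⟨closure T₁, isClosed_closure⟩ : TopologicalSpace.Closeds F₁)).subschemeι x : F₁)}))) ∨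
         Ls' = Ls.map (fun L => closure (υ ⁻¹' (L \ {((AlgebraicGeometry.Scheme.IdealSheafData.vanishingIdeal
            (⟨closure T₁, isClosed_closure⟩ : TopologicalSpace.Closeds F₁)).subschemeι x : F₁)}))) ++
            [υ ⁻¹' {((AlgebraicGeometry.Scheme.IdealSheafData.vanishingIdeal (⟨closure T₁, isClosed_closure⟩ : TopologicalSpace.Closeds F₁)).subschemeι x : F₁)}]) →
        Q F₂ (υ ≫ ρ) (closure (υ ⁻¹' (T₁ \ {((AlgebraicGeometry.Scheme.IdealSheafData.vanishingIdeal
            (⟨closure T₁, isClosed_closure⟩ : TopologicalSpace.Closeds F₁)).subschemeι x : F₁)}))) Ls'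
          (Kp.map (fun t => (closure (υ ⁻¹' (t.1 \ {((AlgebraicGeometry.Scheme.IdealSheafData.vanishingIdeal
              (⟨closure T₁, isClosed_closure⟩ : TopologicalSpace.Closeds F₁)).subschemeι x : F₁)})),
            closure (υ ⁻¹' (t.2.1 \ {((AlgebraicGeometry.Scheme.IdealSheafData.vanishingIdeal
              (⟨closure T₁, isClosed_closure⟩ : TopologicalSpace.Closeds F₁)).subschemeι x : F₁)})),
            closure (υ ⁻¹' (t.2.2 \ {((AlgebraicGeometry.Scheme.IdealSheafData.vanishingIdeal
              (⟨closure T₁, isClosed_closure⟩ : TopologicalSpace.Closeds F₁)).subschemeι x : F₁)})))))) →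
    -- (O) CERTIFIED OPENING (opaque here; Defs8: `Open := OpeningCert k n H ι`, S10's «birth of M♮ + P(x₀) + CAR + PROMOTE» certificate list, text v1.1)
    (∀ (F₃ : AlgebraicGeometry.Scheme.{0}) (ρ₃ : F₃ ⟶ (Literature.AlgebraicGeometry.Motives.projectiveSpace n k).left) (T₃ : Set F₃) (Ls₃ : List (Set F₃))
        (Kp₃ : Option (Set F₃ × Set F₃ × Set F₃)), Open F₃ ρ₃ T₃ Ls₃ Kp₃ → Q F₃ ρ₃ T₃ Ls₃ Kp₃) →
    -- (ii) PAIR ROUND at the transversal crossing curve `Z` of two listed letters `A ≠ B` (stage-level, (T-k)-free): `Z ⊆ T`, `T ⊄ Z`, `Z̃` regular, curve clause,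
    --      `F` regular at the closed points of `Z`; the tag is absent or HOSTS (its pair is `{A, B}`, its key letter is listed and is not a member); every other
    --      listed letter does not contain `Z` and meets it transversally (possibly not at all); letters `↦ St`, tag consumed, optional birth of `E_Z = υ'⁻¹ Z`
    (∀ (F₁ F₃ : AlgebraicGeometry.Scheme.{0}) (ρ : F₁ ⟶ (Literature.AlgebraicGeometry.Motives.projectiveSpace n k).left) (T₁ : Set F₁) (Ls : List (Set F₁))
        (Kp : Option (Set F₁ × Set F₁ × Set F₁)) (A B Z : Set F₁) (hZ : IsClosed Z) (υ' : F₃ ⟶ F₁),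
      Q F₁ ρ T₁ Ls Kp → A ∈ Ls → B ∈ Ls → A ≠ B →
      AlgebraicGeometry.Scheme.IdealSheafData.vanishingIdeal (⟨closure A, isClosed_closure⟩ : TopologicalSpace.Closeds F₁) ⊔
          AlgebraicGeometry.Scheme.IdealSheafData.vanishingIdeal (⟨closure B, isClosed_closure⟩ : TopologicalSpace.Closeds F₁) =
        AlgebraicGeometry.Scheme.IdealSheafData.vanishingIdeal (⟨Z, hZ⟩ : TopologicalSpace.Closeds F₁) →
      Z ⊆ T₁ → ¬ T₁ ⊆ Z → (∀ z : ↥(redSub F₁ Z hZ), IsRegularLocalRing ((redSub F₁ Z hZ).presheaf.stalk z)) →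
      (∀ z : ↥(redSub F₁ Z hZ), IsClosed ({z} : Set ↥(redSub F₁ Z hZ)) → ringKrullDim ((redSub F₁ Z hZ).presheaf.stalk z) = ((1 : ℕ) : WithBot ℕ∞)) →
      (∀ z ∈ Z, IsClosed ({z} : Set F₁) → IsRegularLocalRing (F₁.presheaf.stalk z)) →
      (∀ K A' C' : Set F₁, Kp = some (K, A', C') → K ∈ Ls ∧ K ≠ A ∧ K ≠ B ∧ ((A' = A ∧ C' = B) ∨ (A' = B ∧ C' = A))) →
      (∀ L ∈ Ls, L ≠ A → L ≠ B → (∀ K A' C' : Set F₁, Kp = some (K, A', C') → L ≠ K) →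
        AlgebraicGeometry.Scheme.IdealSheafData.vanishingIdeal (⟨closure L, isClosed_closure⟩ : TopologicalSpace.Closeds F₁) ⊔
            AlgebraicGeometry.Scheme.IdealSheafData.vanishingIdeal (⟨Z, hZ⟩ : TopologicalSpace.Closeds F₁) =
          AlgebraicGeometry.Scheme.IdealSheafData.vanishingIdeal (⟨closure L ∩ Z, isClosed_closure.inter hZ⟩ : TopologicalSpace.Closeds F₁) ∧
        ∀ z ∈ Z, IsClosed ({z} : Set F₁) →
          ¬ Literature.AlgebraicGeometry.Resolution.stalkIdeal (AlgebraicGeometry.Scheme.IdealSheafData.vanishingIdeal (⟨closure L, isClosed_closure⟩ : TopologicalSpace.Closeds F₁)) z ≤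
            Literature.AlgebraicGeometry.Resolution.stalkIdeal (AlgebraicGeometry.Scheme.IdealSheafData.vanishingIdeal (⟨Z, hZ⟩ : TopologicalSpace.Closeds F₁)) z) →
      Literature.AlgebraicGeometry.Resolution.IsBlowup υ' (AlgebraicGeometry.Scheme.IdealSheafData.vanishingIdeal (⟨Z, hZ⟩ : TopologicalSpace.Closeds F₁)) →
      ∀ Ls' : List (Set F₃),
        (Ls' = Ls.map (fun L => closure (υ' ⁻¹' (closure L \ Z))) ∨ Ls' = Ls.map (fun L => closure (υ' ⁻¹' (closure L \ Z))) ++ [υ' ⁻¹' Z]) →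
        Q F₃ (υ' ≫ ρ) (closure (υ' ⁻¹' (T₁ \ Z))) Ls' none) →
    -- (HR-KEEP) HOSTED ROUND inside a listed host `E₁ ∈ Ls` THAT KEEPS ITS MEMBERS (desk R64 (ii)/R65 (i); replaces Defs8's (HR)): the (HR) antecedents VERBATIM
    --      (regular curve `Z ⊆ closure E₁ ∩ T`, `T ⊄ Z`, `Ẽ₁` regular along `Z̃`, `DirStepUnobs` in the host, curve clause) PLUS the pair clause's «other members»
    --      block for every listed `L ≠ E₁` (does not contain `Z`, meets it transversally, possibly not at all); the tag DROPPED; output = EVERY listed letter `↦ St`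
    --      and the BIRTH of `E_Z = υ'⁻¹ Z` (ONE output; (HR)'s `[St E₁] none` and the nested-host `[St E₁, υ'⁻¹ Z]` follow by (D)); supplier = ✓ `TCPlus.hround_keep`
    (∀ (F₁ F₃ : AlgebraicGeometry.Scheme.{0}) (ρ : F₁ ⟶ (Literature.AlgebraicGeometry.Motives.projectiveSpace n k).left) (T₁ : Set F₁) (Ls : List (Set F₁))
        (Kp : Option (Set F₁ × Set F₁ × Set F₁)) (E₁ : Set F₁) (Z : Set F₁) (hZ : IsClosed Z) (υ' : F₃ ⟶ F₁),
      Q F₁ ρ T₁ Ls Kp → E₁ ∈ Ls → Z ⊆ closure E₁ → Z ⊆ T₁ → ¬ T₁ ⊆ Z → (∀ z : ↥(redSub F₁ Z hZ), IsRegularLocalRing ((redSub F₁ Z hZ).presheaf.stalk z)) →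
      (∀ (i : redSub F₁ Z hZ ⟶ redSub F₁ (closure E₁) isClosed_closure), i ≫ redSubι F₁ (closure E₁) isClosed_closure = redSubι F₁ Z hZ →
        ∀ z : ↥(redSub F₁ Z hZ), IsRegularLocalRing ((redSub F₁ (closure E₁) isClosed_closure).presheaf.stalk (i z))) → DirStepUnobs F₁ (closure E₁) isClosed_closure Z hZ →
      (∀ z : ↥(redSub F₁ Z hZ), IsClosed ({z} : Set ↥(redSub F₁ Z hZ)) → ringKrullDim ((redSub F₁ Z hZ).presheaf.stalk z) = ((1 : ℕ) : WithBot ℕ∞)) →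
      (∀ L ∈ Ls, L ≠ E₁ →
        AlgebraicGeometry.Scheme.IdealSheafData.vanishingIdeal (⟨closure L, isClosed_closure⟩ : TopologicalSpace.Closeds F₁) ⊔
            AlgebraicGeometry.Scheme.IdealSheafData.vanishingIdeal (⟨Z, hZ⟩ : TopologicalSpace.Closeds F₁) =
          AlgebraicGeometry.Scheme.IdealSheafData.vanishingIdeal (⟨closure L ∩ Z, isClosed_closure.inter hZ⟩ : TopologicalSpace.Closeds F₁) ∧
        ∀ z ∈ Z, IsClosed ({z} : Set F₁) →
          ¬ Literature.AlgebraicGeometry.Resolution.stalkIdeal (AlgebraicGeometry.Scheme.IdealSheafData.vanishingIdeal (⟨closure L, isClosed_closure⟩ : TopologicalSpace.Closeds F₁)) z ≤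
            Literature.AlgebraicGeometry.Resolution.stalkIdeal (AlgebraicGeometry.Scheme.IdealSheafData.vanishingIdeal (⟨Z, hZ⟩ : TopologicalSpace.Closeds F₁)) z) →
      Literature.AlgebraicGeometry.Resolution.IsBlowup υ' (AlgebraicGeometry.Scheme.IdealSheafData.vanishingIdeal (⟨Z, hZ⟩ : TopologicalSpace.Closeds F₁)) →
      Q F₃ (υ' ≫ ρ) (closure (υ' ⁻¹' (T₁ \ Z))) (Ls.map (fun L => closure (υ' ⁻¹' (closure L \ Z))) ++ [υ' ⁻¹' Z]) none) →
    -- END (C3): the final slots are existential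
    ∃ (Ls : List (Set F')) (Kp : Option (Set F' × Set F' × Set F')), Q F' ρ' T' Ls Kp

/-- **`PrefixReachKeyLetterP7 k n H ι F' ρ' T'`** — the KEPT-MEMBERS PREFIX REACH: `PrefixReachKeyLetterParam7` at the same four slots as `PrefixReachKeyLetterP6`
(`Reach := ReachTowerBTriplePrime`, `ReachL := ReachTowerBQuintPrime ℙⁿ`, `LS := HyperplaneLetters`, `Open := OpeningCertKeyLetter`). [OURS · named predicate] -/
def PrefixReachKeyLetterP7 (k : Type) [Field k] [IsAlgClosed k] (n : ℕ) (H : AlgebraicGeometry.Scheme.{0})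
    (ι : H ⟶ (Literature.AlgebraicGeometry.Motives.projectiveSpace n k).left) (F' : AlgebraicGeometry.Scheme.{0}) (ρ' : F' ⟶ (Literature.AlgebraicGeometry.Motives.projectiveSpace n k).left) (T' : Set F') : Prop :=
  PrefixReachKeyLetterParam7 k n H ι ReachTowerBTriplePrime (ReachTowerBQuintPrime (Literature.AlgebraicGeometry.Motives.projectiveSpace n k).left) (HyperplaneLetters k n H ι) (OpeningCertKeyLetter k n H ι) F' ρ' T'

/-- **`IsoHypReachNDLeavesP7 k n H ι`** — «a KEPT-MEMBERS prefix ends at a stage with (pointwise) ND LEAVES»: (K6-1P) over `PrefixReachKeyLetterP7`.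
[OURS · L1 W4.5b · named hypothesis, no mathematical content of its own] -/
def IsoHypReachNDLeavesP7 (k : Type) [Field k] [IsAlgClosed k] (n : ℕ) (H : AlgebraicGeometry.Scheme.{0})
    (ι : H ⟶ (Literature.AlgebraicGeometry.Motives.projectiveSpace n k).left) : Prop :=
  ∃ (F : AlgebraicGeometry.Scheme.{0}) (ρ : F ⟶ (Literature.AlgebraicGeometry.Motives.projectiveSpace n k).left) (T : Set F) (m : ℕ),
    PrefixReachKeyLetterP7 k n H ι F ρ T ∧ ND.NDInvCLNP n k m F ρ T

/-- **Prefix⁶ ⊆ prefix⁷ (parametric)**: a motive closed under the P7 clauses is closed under Defs8's (HR) — (D) down to `[E₁] none`, (HR-KEEP) at `Ls := [E₁]`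
(its member block is vacuous there), (D) down to `[St E₁] none`; every other clause is passed through unchanged. [OURS · pure logic] -/
theorem prefixReachKeyLetterParam7_of_param (k : Type) [Field k] [IsAlgClosed k] (n : ℕ) (H : AlgebraicGeometry.Scheme.{0})
    (ι : H ⟶ (Literature.AlgebraicGeometry.Motives.projectiveSpace n k).left)
    (Reach : ∀ (F₁ F₂ : AlgebraicGeometry.Scheme.{0}), (F₂ ⟶ F₁) → F₁ → Set F₂ → ∀ (F₉ : AlgebraicGeometry.Scheme.{0}), (F₉ ⟶ F₂) → Set F₉ → Prop)
    (ReachL : ∀ (F₂ : AlgebraicGeometry.Scheme.{0}), (F₂ ⟶ (Literature.AlgebraicGeometry.Motives.projectiveSpace n k).left) →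
      (Literature.AlgebraicGeometry.Motives.projectiveSpace n k).left → Set F₂ → List (Set F₂) → ∀ (F₉ : AlgebraicGeometry.Scheme.{0}), (F₉ ⟶ F₂) → Set F₉ → Prop)
    (LS : ∀ (F₂ : AlgebraicGeometry.Scheme.{0}), (F₂ ⟶ (Literature.AlgebraicGeometry.Motives.projectiveSpace n k).left) →
      (Literature.AlgebraicGeometry.Motives.projectiveSpace n k).left → List (Set F₂) → Prop)
    (Open : ∀ (F₃ : AlgebraicGeometry.Scheme.{0}), (F₃ ⟶ (Literature.AlgebraicGeometry.Motives.projectiveSpace n k).left) → Set F₃ → List (Set F₃) →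
      Option (Set F₃ × Set F₃ × Set F₃) → Prop)
    (F' : AlgebraicGeometry.Scheme.{0}) (ρ' : F' ⟶ (Literature.AlgebraicGeometry.Motives.projectiveSpace n k).left) (T' : Set F')
    (h : PrefixReachKeyLetterParam k n H ι Reach ReachL LS Open F' ρ' T') : PrefixReachKeyLetterParam7 k n H ι Reach ReachL LS Open F' ρ' T' := by
  intro Q h0 hD hPc hPL hi hO hii hHRK
  refine h Q h0 hD hPc hPL hi hO hii ?_
  intro F₁ F₃ ρ T₁ Ls Kp E₁ Z hZ υ' hQ hE₁ hZE hZT hTZ hZreg hEreg hunobs hZdim hυ'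
  -- (D) down to the host alone, no tag
  have hQ₁ : Q F₁ ρ T₁ [E₁] none :=
    hD F₁ ρ T₁ Ls [E₁] Kp none hQ (fun L hL => by rw [List.mem_singleton] at hL; subst hL; exact hE₁) (Or.inr rfl)
  -- (HR-KEEP) at `Ls := [E₁]`: the member block is vacuous
  have hQ₃ : Q F₃ (υ' ≫ ρ) (closure (υ' ⁻¹' (T₁ \ Z))) ([E₁].map (fun L => closure (υ' ⁻¹' (closure L \ Z))) ++ [υ' ⁻¹' Z]) none :=
    hHRK F₁ F₃ ρ T₁ [E₁] none E₁ Z hZ υ' hQ₁ (List.mem_singleton_self E₁) hZE hZT hTZ hZreg hEreg hunobs hZdim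
      (fun L hL hLe => absurd (List.mem_singleton.mp hL) hLe) hυ'
  -- (D) down to the host's strict transform
  exact hD F₃ (υ' ≫ ρ) (closure (υ' ⁻¹' (T₁ \ Z))) _ [closure (υ' ⁻¹' (closure E₁ \ Z))] none none hQ₃
    (fun L hL => by rw [List.mem_singleton] at hL; subst hL; simp) (Or.inl rfl)

/-- **Prefix⁶ ⊆ prefix⁷** at the four slots of record. [OURS · pure logic] -/
theorem prefixReachKeyLetterP7_of_P6 (k : Type) [Field k] [IsAlgClosed k] (n : ℕ) (H : AlgebraicGeometry.Scheme.{0})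
    (ι : H ⟶ (Literature.AlgebraicGeometry.Motives.projectiveSpace n k).left) (F' : AlgebraicGeometry.Scheme.{0}) (ρ' : F' ⟶ (Literature.AlgebraicGeometry.Motives.projectiveSpace n k).left) (T' : Set F')
    (h : PrefixReachKeyLetterP6 k n H ι F' ρ' T') : PrefixReachKeyLetterP7 k n H ι F' ρ' T' :=
  prefixReachKeyLetterParam7_of_param k n H ι _ _ _ _ F' ρ' T' h

/-- ★ **Inclusion P6 ⊆ P7** (the REPLACE cut `¬ IsoHypReachNDLeavesP6 ↦ ¬ IsoHypReachNDLeavesP7` loses nothing). [OURS · pure logic] -/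
theorem isoHypReachNDLeavesP7_of_P6 (k : Type) [Field k] [IsAlgClosed k] (n : ℕ) (H : AlgebraicGeometry.Scheme.{0})
    (ι : H ⟶ (Literature.AlgebraicGeometry.Motives.projectiveSpace n k).left) (h : IsoHypReachNDLeavesP6 k n H ι) : IsoHypReachNDLeavesP7 k n H ι := by
  obtain ⟨F, ρ, T, m, hpre, hND⟩ := h
  exact ⟨F, ρ, T, m, prefixReachKeyLetterP7_of_P6 k n H ι F ρ T hpre, hND⟩

/-- **Inclusion P5 ⊆ P7** (via ✓ `isoHypReachNDLeavesP6_of_P5`). [OURS · pure logic] -/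
theorem isoHypReachNDLeavesP7_of_P5 (k : Type) [Field k] [IsAlgClosed k] (n : ℕ) (H : AlgebraicGeometry.Scheme.{0})
    (ι : H ⟶ (Literature.AlgebraicGeometry.Motives.projectiveSpace n k).left) (h : IsoHypReachNDLeavesP5 k n H ι) : IsoHypReachNDLeavesP7 k n H ι :=
  isoHypReachNDLeavesP7_of_P6 k n H ι (isoHypReachNDLeavesP6_of_P5 k n H ι h)

/-- **Inclusion P ⊆ P7** (via ✓ `isoHypReachNDLeavesP6_of_P`). [OURS · pure logic] -/
theorem isoHypReachNDLeavesP7_of_P (k : Type) [Field k] [IsAlgClosed k] (n : ℕ) (H : AlgebraicGeometry.Scheme.{0})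
    (ι : H ⟶ (Literature.AlgebraicGeometry.Motives.projectiveSpace n k).left) (h : IsoHypReachNDLeavesP k n H ι) : IsoHypReachNDLeavesP7 k n H ι :=
  isoHypReachNDLeavesP7_of_P6 k n H ι (isoHypReachNDLeavesP6_of_P k n H ι h)

/-- Contrapositive form, as the REPLACE cut consumes it (the REGISTERED hypothesis of `stub_elnat_three_isolated_nonNDLeaves6` is `¬ IsoHypReachNDLeavesP6`).
[OURS · pure logic] -/
theorem not_isoHypReachNDLeavesP6_of_not_P7 (k : Type) [Field k] [IsAlgClosed k] (n : ℕ) (H : AlgebraicGeometry.Scheme.{0})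
    (ι : H ⟶ (Literature.AlgebraicGeometry.Motives.projectiveSpace n k).left) (h : ¬ IsoHypReachNDLeavesP7 k n H ι) : ¬ IsoHypReachNDLeavesP6 k n H ι :=
  fun h' => h (isoHypReachNDLeavesP7_of_P6 k n H ι h')

end Summit.ResolutionOfSingularities.ResolutionOfSingularities.Cruxes.EquisingularLiftNat.Sections

end
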